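import Literature.AlgebraicGeometry.Deformation.MorphismLiftsSquareZeroCechCoboundary
import HarnessLib

/-!
# From a Čech coboundary to a global lift: correcting the local lifts by the 0-cochain and gluing
# ([SGA1] III Prop. 5.1: «si la classe est nulle, les prolongements locaux corrigés se recollent»; [MFK94] Prop. 6.15)

Layer `Literature/AlgebraicGeometry/Deformation` (cell hodgecm-mathlib, (E) of [MFK94] Prop. 6.15, brick C4 §4 (T2) of
`B-provers/B-p01/g16/SOCKETS-A4b-FileA-E.v0`).  THEOREMS ONLY.  Over ★ `MorphismLiftsSquareZeroCechCoboundary`.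

* §1 `charts_eq_of_matrix_zero` — a pair whose coordinate matrix VANISHES has equal charts (`d_ρ ∈ 𝔪·Γ(Z, W)` and
  `J·𝔪 = 0`), hence the two restricted lifts coincide (★ O5 `eq_of_charts_eq`);
* §2 `exists_derivation_of_matrix` — every matrix `m` is REALISED: the `A`-derivation
  `ε(a) = ∑_ρ j_ρ · ℓ(∑_t ψ₀(λ_t(d(G♯a))) · m ρ t)` of `Γ(X, V)` into `ker i♯_U = J·Γ(Z, U)` (`ℓ` any set-theoretic section of
  `pr♯`), and the corrected lift `g + ε` (★ O5 `exists_lift_of_derivation`) has matrix `m` relative to `g`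
  (`pchar_of_difference_eq`);
* §3 **`exists_lift_of_cechCochain_mem_cechB1`** — if cochains `c ρ t` carrying the characteristic identities of the
  local lifts `(g_α)` are COBOUNDARIES `d⁰(b ρ t)`, the lifts corrected by `−b` have vanishing pairwise matrices
  (★ `matrix_add`, `matrix_restrict`), agree on the overlaps (§1), and glue (★ O5 `existsUnique_glue_of_lifts`) to a global
  `S`-morphism `G_Z : Z → X` with `i ≫ G_Z = f₀`.

HC_CM is proved only modulo the 7 printed citations until rung 0 closes; this file discharges none of them.

## References
* [SGA1] A. Grothendieck, M. Raynaud, *SGA 1*, LNM 224 / arXiv:math/0206203: Exp. III §5 Prop. 5.1 (arXiv ed. p. 71).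
* [MumfordFogartyKirwan1994] D. Mumford, J. Fogarty, F. Kirwan, *Geometric Invariant Theory*, 3rd ed. (1994), Ch. 6 §3
  Prop. 6.15 (pp. 124–125).
-/

noncomputable section

universe u

open CategoryTheory CategoryTheory.Limits AlgebraicGeometry Opposite IsLocalRing

namespace Literature.AlgebraicGeometry.Deformation

open Literature.AlgebraicGeometry.Modules Literature.AlgebraicGeometry.Motives Literature.AlgebraicGeometry.HodgeTheory
  Literature.AlgebraicGeometry.Morphisms

/-! ### §1 A vanishing matrix forces equal charts -/

section Zero

variable {A : Type u} [CommRing A] [IsLocalRing A] (J : Ideal A) {r : ℕ} (j : Fin r → A)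
  {X : Scheme.{u}} (p : X ⟶ Spec (.of A)) {X₀ : Over (Spec (.of (A ⧸ J)))} {G : X₀.left ⟶ X}
  (hG : IsPullback G X₀.hom p (Spec.map (CommRingCat.ofHom (Ideal.Quotient.mk J))))
  {I : Type u} [Fintype I] (e : SheafOfModules.free I ≅ (cotangentSheaf X₀).over ⊤)
  {Z Zb : Scheme.{u}} (q : Z ⟶ Spec (.of A)) {qb : Zb ⟶ Spec (.of (ResidueField A))} {pr : Zb ⟶ Z}
  (hpr : IsPullback pr qb q (Spec.map (CommRingCat.ofHom (residue A))))

include hG hpr in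
/-- **A pair with ZERO matrix has equal charts**: if `cm = 0` satisfies the characteristic identities of `(ψ₁, ψ₂)` then
`ψ₂ = ψ₁` — every decomposition `ψ₂(a) − ψ₁(a) = ∑ j_ρ d_ρ` has `pr♯(d_ρ) = 0`, i.e. `d_ρ ∈ 𝔪·Γ(Z, W)`, and `J·𝔪 = 0`
(★ C3 `sum_mul_eq_sum_mul_of_sub_mem`). [cite: SGA1, Exp. III §5 Prop. 5.1] -/
theorem charts_eq_of_matrix_zero (hj : ∀ ρ, j ρ ∈ J) (hspan : J ≤ Ideal.span (Set.range j))
    (hmJ : maximalIdeal A * J = ⊥) (hJle : J ≤ maximalIdeal A)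
    {V' : X.Opens} (hV' : IsAffineOpen V') {W : Z.Opens} (hW : IsAffineOpen W) {Wb : Zb.Opens} (hWb : Wb = pr ⁻¹ᵁ W)
    (ψ₁ ψ₂ : Γ(X, V') →+* Γ(Z, W))
    (hs₁ : ∀ x : A, ψ₁ (X.presheaf.map (homOfLE (le_top : V' ≤ ⊤)).op (specStructureMap p x)) =
      Z.presheaf.map (homOfLE (le_top : W ≤ ⊤)).op (specStructureMap q x))
    (hδ₁₂ : ∀ a, ψ₂ a - ψ₁ a ∈ J.map ((Z.presheaf.map (homOfLE (le_top : W ≤ ⊤)).op).hom.comp (specStructureMap q)))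
    (h : ∀ (ψ₀ : Γ(X₀.left, G ⁻¹ᵁ V') →+* Γ(Zb, Wb)), (∀ a, ψ₀ (G.app V' a) = pr.appLE W Wb hWb.le (ψ₁ a)) →
      ∀ (a : Γ(X, V')) (d : Fin r → Γ(Z, W)),
        ψ₂ a - ψ₁ a = ∑ ρ, Z.presheaf.map (homOfLE (le_top : W ≤ ⊤)).op (specStructureMap q (j ρ)) * d ρ →
        ∀ ρ, pr.appLE W Wb hWb.le (d ρ) =
          ∑ t, ψ₀ (coord e (homOfLE le_top) (dSection X₀ (G ⁻¹ᵁ V') (G.app V' a)) t) * (0 : Fin r → I → Γ(Zb, Wb)) ρ t) :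
    ∀ a, ψ₂ a = ψ₁ a := by
  classical
  letI algZ : Algebra A Γ(Z, W) :=
    ((Z.presheaf.map (homOfLE (le_top : W ≤ ⊤)).op).hom.comp (specStructureMap q)).toAlgebra
  obtain ⟨ψ₀, hψ₀⟩ := exists_reducedChart J hG hpr hJle hV' hW hWb ψ₁ hs₁
  obtain ⟨-, hθk⟩ := appLE_surjective_and_ker_eq_of_eq pr hWb (app_surjective_and_ker_eq_of_isPullback_residue hpr ⟨W, hW⟩).1
  have hkerθ : RingHom.ker (pr.appLE W Wb hWb.le).hom = (maximalIdeal A).map (algebraMap A Γ(Z, W)) := by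
    rw [hθk]; exact (app_surjective_and_ker_eq_of_isPullback_residue hpr ⟨W, hW⟩).2
  intro a
  obtain ⟨d, hd⟩ := exists_eq_sum_mul_of_mem_map (C := Γ(Z, W)) j hspan (hδ₁₂ a)
  have hd0 : ∀ ρ, d ρ - 0 ∈ (maximalIdeal A).map (algebraMap A Γ(Z, W)) := fun ρ => by
    rw [sub_zero, ← hkerθ, RingHom.mem_ker]
    have h0 := h ψ₀ hψ₀ a d hd ρ
    simpa using h0
  have hsum := sum_mul_eq_sum_mul_of_sub_mem (C := Γ(Z, W)) j hj hmJ hd0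
  rw [← sub_eq_zero, hd, hsum]
  simp

end Zero

/-! ### §2 Every matrix is realised by a derivation; the corrected lift has that matrix -/

section Realise

variable {A : Type u} [CommRing A] [IsLocalRing A] (J : Ideal A) {r : ℕ} (j : Fin r → A)
  {X : Scheme.{u}} (p : X ⟶ Spec (.of A)) {X₀ : Over (Spec (.of (A ⧸ J)))} {G : X₀.left ⟶ X}
  (hG : IsPullback G X₀.hom p (Spec.map (CommRingCat.ofHom (Ideal.Quotient.mk J))))
  {I : Type u} [Fintype I] (e : SheafOfModules.free I ≅ (cotangentSheaf X₀).over ⊤)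
  {Z Z₀ Zb : Scheme.{u}} (q : Z ⟶ Spec (.of A)) {q₀ : Z₀ ⟶ Spec (.of (A ⧸ J))} {i : Z₀ ⟶ Z}
  (hi : IsPullback i q₀ q (Spec.map (CommRingCat.ofHom (Ideal.Quotient.mk J))))
  {qb : Zb ⟶ Spec (.of (ResidueField A))} {pr : Zb ⟶ Z}
  (hpr : IsPullback pr qb q (Spec.map (CommRingCat.ofHom (residue A))))
  {U' : Z.Opens} (hU' : IsAffineOpen U') {V' : X.Opens} (hV' : IsAffineOpen V') {Wb : Zb.Opens} (hWb : Wb = pr ⁻¹ᵁ U')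
  (g₁ : Spec (.of Γ(Z, U')) ⟶ X)

/-- `∑ j_ρ c_ρ` only depends on the `pr♯(c_ρ)` (`ker pr♯ = 𝔪·Γ(Z, U)`, `𝔪·J = 0`). [cite: Hartshorne2010, §6 Notation 6.1 (pp. 45–46)] -/
theorem sum_mul_eq_of_appLE_eq (hj : ∀ ρ, j ρ ∈ J) (hmJ : maximalIdeal A * J = ⊥)
    (hkerθ : RingHom.ker (pr.appLE U' Wb hWb.le).hom =
      (maximalIdeal A).map ((Z.presheaf.map (homOfLE (le_top : U' ≤ ⊤)).op).hom.comp (specStructureMap q)))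
    {c c' : Fin r → Γ(Z, U')} (h : ∀ ρ, pr.appLE U' Wb hWb.le (c ρ) = pr.appLE U' Wb hWb.le (c' ρ)) :
    ∑ ρ, Z.presheaf.map (homOfLE (le_top : U' ≤ ⊤)).op (specStructureMap q (j ρ)) * c ρ =
      ∑ ρ, Z.presheaf.map (homOfLE (le_top : U' ≤ ⊤)).op (specStructureMap q (j ρ)) * c' ρ := by
  letI algZ : Algebra A Γ(Z, U') :=
    ((Z.presheaf.map (homOfLE (le_top : U' ≤ ⊤)).op).hom.comp (specStructureMap q)).toAlgebra
  refine sum_mul_eq_sum_mul_of_sub_mem (C := Γ(Z, U')) j hj hmJ fun ρ => ?_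
  change c ρ - c' ρ ∈ (maximalIdeal A).map ((Z.presheaf.map (homOfLE (le_top : U' ≤ ⊤)).op).hom.comp (specStructureMap q))
  rw [← hkerθ, RingHom.mem_ker, map_sub, sub_eq_zero]
  exact h ρ

include hG hi hpr hU' hV' in
/-- **Every matrix is the matrix of a derivation** ([SGA1] III 5.1: the action of `𝒢(U) = Der(Γ(X,V), 𝒥(U))` on the lifts;
here `𝒥(U) = J·Γ(Z, U) = ⊕_ρ j_ρ·Γ(Z̄, Ū)` and `Der = Γ(Z̄, Ū)^{r×I}` through the coframe).  For a local `S`-lift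
`g₁ : Spec Γ(Z, U) → X` through the affine `V`, with chart `ψ₁`, a reduced chart `ψ₀`, a set-theoretic section `ℓ` of
`pr♯ : Γ(Z, U) ↠ Γ(Z̄, Ū)` and a matrix `m : Fin r → I → Γ(Z̄, Ū)`, the map
`ε(a) = ∑_ρ j_ρ · ℓ(∑_t ψ₀(λ_t(d(G♯a))) · m ρ t)` is an `A`-DERIVATION of `Γ(X, V)` into `ker i♯_U` (Leibniz and additivity
hold exactly because the defects lie in `𝔪·Γ(Z, U)`, killed by the `j_ρ`; ★ C1 `sum_coord_dSection_add/mul/const`).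
[cite: SGA1, Exp. III §5 Prop. 5.1] [cite: MumfordFogartyKirwan1994, Ch. 6 §3 Prop. 6.15 (pp. 124–125)] -/
theorem exists_derivation_of_matrix (hj : ∀ ρ, j ρ ∈ J) (hmJ : maximalIdeal A * J = ⊥) (hJle : J ≤ maximalIdeal A)
    (w₁ : g₁ ≫ p = hU'.fromSpec ≫ q) (hg₁ : g₁ ⁻¹ᵁ V' = ⊤) (m : Fin r → I → Γ(Zb, Wb)) :
    letI : Algebra A Γ(Z, U') := ((Z.presheaf.map (homOfLE (le_top : U' ≤ ⊤)).op).hom.comp (specStructureMap q)).toAlgebra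
    letI : Algebra A Γ(X, V') := ((Scheme.ΓSpecIso (.of A)).inv ≫ p.appLE ⊤ V' le_top).hom.toAlgebra
    letI : Algebra Γ(X, V') Γ(Z, U') := (g₁.appLE V' ⊤ hg₁.ge ≫ (Scheme.ΓSpecIso (.of Γ(Z, U'))).hom).hom.toAlgebra
    ∃ (ε : Derivation A Γ(X, V') (RingHom.ker (i.app U').hom))
      (ψ₀ : Γ(X₀.left, G ⁻¹ᵁ V') →+* Γ(Zb, Wb)) (ℓ : Γ(Zb, Wb) → Γ(Z, U')),
      (∀ a, ψ₀ (G.app V' a) = pr.appLE U' Wb hWb.le ((g₁.appLE V' ⊤ hg₁.ge ≫ (Scheme.ΓSpecIso (.of Γ(Z, U'))).hom) a)) ∧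
      (∀ y, pr.appLE U' Wb hWb.le (ℓ y) = y) ∧
      ∀ a, (ε a : Γ(Z, U')) = ∑ ρ, Z.presheaf.map (homOfLE (le_top : U' ≤ ⊤)).op (specStructureMap q (j ρ)) *
          ℓ (∑ t, ψ₀ (coord e (homOfLE le_top) (dSection X₀ (G ⁻¹ᵁ V') (G.app V' a)) t) * m ρ t) := by
  classical
  set sZ : A →+* Γ(Z, U') := ((Z.presheaf.map (homOfLE (le_top : U' ≤ ⊤)).op).hom.comp (specStructureMap q)) with hsZ
  set sV : CommRingCat.of A ⟶ Γ(X, V') := (Scheme.ΓSpecIso (.of A)).inv ≫ p.appLE ⊤ V' le_top with hsV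
  set ψ₁ : Γ(X, V') ⟶ CommRingCat.of Γ(Z, U') := g₁.appLE V' ⊤ hg₁.ge ≫ (Scheme.ΓSpecIso (.of Γ(Z, U'))).hom with hψ₁
  letI algZ : Algebra A Γ(Z, U') := sZ.toAlgebra
  letI algV : Algebra A Γ(X, V') := sV.hom.toAlgebra
  letI algVB : Algebra Γ(X, V') Γ(Z, U') := ψ₁.hom.toAlgebra
  -- the chart is an `A`-algebra map
  have halg : CommRingCat.ofHom (algebraMap A Γ(Z, U')) = (Scheme.ΓSpecIso (.of A)).inv ≫ q.appLE ⊤ U' le_top := rfl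
  have w₁' : g₁ ≫ p = Spec.map (CommRingCat.ofHom (algebraMap A Γ(Z, U'))) := by
    rw [halg, ← fromSpec_comp_eq_specMap hU' q]; exact w₁
  have hc₁ : sV ≫ ψ₁ = CommRingCat.ofHom (algebraMap A Γ(Z, U')) :=
    (comp_eq_specMap_algebraMap_iff hV' p _).mp ((eq_specMap_appLE_comp_fromSpec hV' g₁ hg₁) ▸ w₁')
  have hs₁ : ∀ x : A, ψ₁ (sV x) = sZ x := fun x => (congrArg (fun φ => φ.hom x) hc₁).trans rfl
  have hs₁' : ∀ x : A, ψ₁.hom (X.presheaf.map (homOfLE (le_top : V' ≤ ⊤)).op (specStructureMap p x)) =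
      Z.presheaf.map (homOfLE (le_top : U' ≤ ⊤)).op (specStructureMap q x) := fun x => hs₁ x
  -- `θ = pr♯`, a section `ℓ`, the reduced chart `ψ₀`
  obtain ⟨hθs, hθk⟩ := appLE_surjective_and_ker_eq_of_eq pr hWb (app_surjective_and_ker_eq_of_isPullback_residue hpr ⟨U', hU'⟩).1
  have hkerθ : RingHom.ker (pr.appLE U' Wb hWb.le).hom =
      (maximalIdeal A).map ((Z.presheaf.map (homOfLE (le_top : U' ≤ ⊤)).op).hom.comp (specStructureMap q)) := by
    rw [hθk]; exact (app_surjective_and_ker_eq_of_isPullback_residue hpr ⟨U', hU'⟩).2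
  set θ := pr.appLE U' Wb hWb.le with hθ
  let ℓ : Γ(Zb, Wb) → Γ(Z, U') := Function.surjInv hθs
  have hℓ : ∀ y, θ (ℓ y) = y := fun y => Function.surjInv_eq hθs y
  obtain ⟨ψ₀, hψ₀⟩ := exists_reducedChart J hG hpr hJle hV' hU' hWb ψ₁.hom hs₁'
  obtain ⟨hsurjG, hkerG⟩ := app_surjective_and_ker_eq_of_isPullback_mk J hG ⟨V', hV'⟩
  have hV₀ : IsAffineOpen (G ⁻¹ᵁ V') := isAffineOpen_preimage_of_isPullback_mk J hG ⟨V', hV'⟩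
  -- the inner Leibniz maps `F ρ`
  let F : Fin r → Γ(X, V') → Γ(Zb, Wb) := fun ρ a =>
    ∑ t, ψ₀ (coord e (homOfLE le_top) (dSection X₀ (G ⁻¹ᵁ V') (G.app V' a)) t) * m ρ t
  have F_add : ∀ ρ a b, F ρ (a + b) = F ρ a + F ρ b := fun ρ a b => by
    simp only [F, map_add]
    exact sum_coord_dSection_add e (homOfLE le_top) ψ₀ (m ρ) _ _
  have F_mul : ∀ ρ a b, F ρ (a * b) = θ (ψ₁ a) * F ρ b + θ (ψ₁ b) * F ρ a := fun ρ a b => by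
    simp only [F, map_mul]
    have h := sum_coord_dSection_mul e (homOfLE le_top) ψ₀ (m ρ) (G.app V' a) (G.app V' b)
    simp only [smul_eq_mul, Finset.mul_sum] at h
    rw [h, hψ₀, hψ₀, Finset.mul_sum, Finset.mul_sum]
  have F_const : ∀ ρ (x : A), F ρ (sV x) = 0 := fun ρ x => by
    simp only [F]
    have hx : G.app V' (sV x) = (constToPresheaf X₀).app (op (G ⁻¹ᵁ V')) (Ideal.Quotient.mk J x) := by
      rw [constToPresheaf_app_eq]
      exact app_specStructureMap_of_isPullback_mk J hG V' x
    rw [hx]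
    exact sum_coord_dSection_constToPresheaf_app e (homOfLE le_top) ψ₀ (m ρ) _
  -- `E = ∑ j_ρ ℓ(F ρ)` and its properties, exact because the defects are in `𝔪·Γ(Z, U)`
  let E : Γ(X, V') → Γ(Z, U') := fun a => ∑ ρ, sZ (j ρ) * ℓ (F ρ a)
  have KT : ∀ {c c' : Fin r → Γ(Z, U')}, (∀ ρ, θ (c ρ) = θ (c' ρ)) →
      ∑ ρ, sZ (j ρ) * c ρ = ∑ ρ, sZ (j ρ) * c' ρ := fun h => sum_mul_eq_of_appLE_eq J j q hWb hj hmJ hkerθ h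
  have E_mem : ∀ a, E a ∈ RingHom.ker (i.app U').hom := fun a => by
    rw [(app_surjective_and_ker_eq_of_isPullback_mk J hi ⟨U', hU'⟩).2]
    exact sum_mul_mem_map (C := Γ(Z, U')) j hj _
  have E_add : ∀ a b, E (a + b) = E a + E b := fun a b => by
    simp only [E]
    rw [KT (c' := fun ρ => ℓ (F ρ a) + ℓ (F ρ b)) (fun ρ => by rw [F_add, map_add, hℓ, hℓ, hℓ])]
    simp only [mul_add, Finset.sum_add_distrib]
  have E_mul : ∀ a b, E (a * b) = ψ₁ a * E b + ψ₁ b * E a := fun a b => by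
    simp only [E]
    rw [KT (c' := fun ρ => ψ₁ a * ℓ (F ρ b) + ψ₁ b * ℓ (F ρ a))
      (fun ρ => by rw [F_mul, map_add, map_mul, map_mul, hℓ, hℓ, hℓ])]
    simp only [mul_add, Finset.sum_add_distrib, Finset.mul_sum]
    congr 1 <;> exact Finset.sum_congr rfl fun ρ _ => by ring
  have E_const : ∀ x : A, E (sV x) = 0 := fun x => by
    simp only [E]
    rw [KT (c' := fun _ => 0) (fun ρ => by rw [F_const, hℓ, map_zero])]
    simp
  have E_smul : ∀ (x : A) (a : Γ(X, V')), E (x • a) = x • E a := fun x a => by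
    rw [Algebra.smul_def, Algebra.smul_def, E_mul]
    change ψ₁ (sV x) * E a + ψ₁ a * E (sV x) = sZ x * E a
    rw [E_const, mul_zero, add_zero, hs₁]
  -- the derivation
  let εₗ : Γ(X, V') →ₗ[A] RingHom.ker (i.app U').hom :=
    { toFun := fun a => ⟨E a, E_mem a⟩
      map_add' := fun a b => Subtype.ext (E_add a b)
      map_smul' := fun x a => Subtype.ext (by
        change E (x • a) = x • E a
        exact E_smul x a) }
  let ε : Derivation A Γ(X, V') (RingHom.ker (i.app U').hom) :=
    Derivation.mk' εₗ fun a b => Subtype.ext (by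
      change E (a * b) = ψ₁ a * E b + ψ₁ b * E a
      exact E_mul a b)
  exact ⟨ε, ψ₀, ℓ, hψ₀, hℓ, fun a => rfl⟩

include hG hpr hU' hV' in
/-- **The corrected lift has the prescribed matrix**: if `ψ₂(a) − ψ₁(a) = ∑_ρ j_ρ ℓ(∑_t ψ₀(λ_t(d(G♯a))) · m ρ t)` for all
`a` (the charts of `g₁` and of `g₁ + ε`, ★ O5 `exists_lift_of_derivation`), then `m` satisfies the characteristic
identities of the pair `(ψ₁, ψ₂)` (uniqueness of coordinates modulo `𝔪` on the flat `Γ(Z, U)`, ★ C3).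
[cite: SGA1, Exp. III §5 Prop. 5.1] -/
theorem pchar_of_difference_eq [Flat q] (hind : ∀ a : Fin r → A, ∑ ρ, a ρ * j ρ = 0 → ∀ ρ, a ρ ∈ maximalIdeal A)
    (hg₁ : g₁ ⁻¹ᵁ V' = ⊤) (m : Fin r → I → Γ(Zb, Wb)) (ψ₀ : Γ(X₀.left, G ⁻¹ᵁ V') →+* Γ(Zb, Wb))
    (ℓ : Γ(Zb, Wb) → Γ(Z, U'))
    (hψ₀ : ∀ a, ψ₀ (G.app V' a) = pr.appLE U' Wb hWb.le ((g₁.appLE V' ⊤ hg₁.ge ≫ (Scheme.ΓSpecIso (.of Γ(Z, U'))).hom) a))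
    (hℓ : ∀ y, pr.appLE U' Wb hWb.le (ℓ y) = y) (ψ₂ : Γ(X, V') →+* Γ(Z, U'))
    (hdiff : ∀ a, ψ₂ a - (g₁.appLE V' ⊤ hg₁.ge ≫ (Scheme.ΓSpecIso (.of Γ(Z, U'))).hom) a =
      ∑ ρ, Z.presheaf.map (homOfLE (le_top : U' ≤ ⊤)).op (specStructureMap q (j ρ)) *
        ℓ (∑ t, ψ₀ (coord e (homOfLE le_top) (dSection X₀ (G ⁻¹ᵁ V') (G.app V' a)) t) * m ρ t)) :
    ∀ (ψ₀' : Γ(X₀.left, G ⁻¹ᵁ V') →+* Γ(Zb, Wb)),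
      (∀ a, ψ₀' (G.app V' a) = pr.appLE U' Wb hWb.le ((g₁.appLE V' ⊤ hg₁.ge ≫ (Scheme.ΓSpecIso (.of Γ(Z, U'))).hom) a)) →
      ∀ (a : Γ(X, V')) (d : Fin r → Γ(Z, U')),
        ψ₂ a - (g₁.appLE V' ⊤ hg₁.ge ≫ (Scheme.ΓSpecIso (.of Γ(Z, U'))).hom) a =
          ∑ ρ, Z.presheaf.map (homOfLE (le_top : U' ≤ ⊤)).op (specStructureMap q (j ρ)) * d ρ →
        ∀ ρ, pr.appLE U' Wb hWb.le (d ρ) =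
          ∑ t, ψ₀' (coord e (homOfLE le_top) (dSection X₀ (G ⁻¹ᵁ V') (G.app V' a)) t) * m ρ t := by
  classical
  letI algZ : Algebra A Γ(Z, U') :=
    ((Z.presheaf.map (homOfLE (le_top : U' ≤ ⊤)).op).hom.comp (specStructureMap q)).toAlgebra
  haveI : Module.Flat A Γ(Z, U') := moduleFlat_sections_of_flat q hU'
  obtain ⟨hsurjG, -⟩ := app_surjective_and_ker_eq_of_isPullback_mk J hG ⟨V', hV'⟩
  obtain ⟨-, hθk⟩ := appLE_surjective_and_ker_eq_of_eq pr hWb (app_surjective_and_ker_eq_of_isPullback_residue hpr ⟨U', hU'⟩).1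
  have hkerθ : RingHom.ker (pr.appLE U' Wb hWb.le).hom = (maximalIdeal A).map (algebraMap A Γ(Z, U')) := by
    rw [hθk]; exact (app_surjective_and_ker_eq_of_isPullback_residue hpr ⟨U', hU'⟩).2
  intro ψ₀' hψ₀' a d hd ρ
  have hψeq : ψ₀' = ψ₀ := reducedChart_unique (J := J) hsurjG hψ₀' hψ₀
  subst hψeq
  have hdiff' := sub_mem_map_maximalIdeal_of_sum_mul_eq j hind ((hd.symm.trans (hdiff a))) ρ
  rw [← hkerθ, RingHom.mem_ker, map_sub, sub_eq_zero, hℓ] at hdiff'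
  exact hdiff'

end Realise

/-! ### §3 The corrected lift on one chart -/

section Corrected

variable {A : Type u} [CommRing A] [IsLocalRing A] (J : Ideal A) {r : ℕ} (j : Fin r → A)
  {X : Scheme.{u}} (p : X ⟶ Spec (.of A)) {X₀ : Over (Spec (.of (A ⧸ J)))} {G : X₀.left ⟶ X}
  (hG : IsPullback G X₀.hom p (Spec.map (CommRingCat.ofHom (Ideal.Quotient.mk J))))
  {I : Type u} [Fintype I] (e : SheafOfModules.free I ≅ (cotangentSheaf X₀).over ⊤)
  {Z Z₀ Zb : Scheme.{u}} (q : Z ⟶ Spec (.of A)) {q₀ : Z₀ ⟶ Spec (.of (A ⧸ J))} {i : Z₀ ⟶ Z}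
  (hi : IsPullback i q₀ q (Spec.map (CommRingCat.ofHom (Ideal.Quotient.mk J))))
  {qb : Zb ⟶ Spec (.of (ResidueField A))} {pr : Zb ⟶ Z}
  (hpr : IsPullback pr qb q (Spec.map (CommRingCat.ofHom (residue A))))
  (f₀ : Z₀ ⟶ X) {U' : Z.Opens} (hU' : IsAffineOpen U') {V' : X.Opens} (hV' : IsAffineOpen V') {Wb : Zb.Opens}
  (hWb : Wb = pr ⁻¹ᵁ U') (g₁ : Spec (.of Γ(Z, U')) ⟶ X)

/-- Restricting along the identity `U ≤ U` does nothing: `Spec (res_{U,U}) ≫ g = g`. [cite: SGA1, Exp. III §5 Prop. 5.1] -/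
theorem specMap_res_refl_comp (t : Spec (.of Γ(Z, U')) ⟶ X) :
    Spec.map (Z.presheaf.map (homOfLE (le_refl U')).op) ≫ t = t := by
  rw [show homOfLE (le_refl U') = 𝟙 U' from Subsingleton.elim _ _, op_id, Z.presheaf.map_id, Spec.map_id,
    Category.id_comp]

include hG hi hpr hU' hV' in
/-- **The corrected lift on one chart** ([SGA1] III 5.1: the action of `𝒢(U)` on the local extensions): for a local
`S`-lift `g₁ : Spec Γ(Z, U) → X` of `f₀` through the affine `V` and a matrix `m : Fin r → I → Γ(Z̄, Ū)`, there is a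
local `S`-lift `g₂` of `f₀` through `V` (★ O5 `exists_lift_of_derivation` applied to the derivation of ★
`exists_derivation_of_matrix`) such that `m` satisfies the characteristic identities of the pair `(g₁, g₂)` read on
`U` (charts through `res_{U,U}`). [cite: SGA1, Exp. III §5 Prop. 5.1] [cite: MumfordFogartyKirwan1994, Ch. 6 §3 Prop. 6.15 (pp. 124–125)] -/
theorem exists_corrected_lift [Flat q] (hj : ∀ ρ, j ρ ∈ J) (hmJ : maximalIdeal A * J = ⊥) (hJle : J ≤ maximalIdeal A)
    (hind : ∀ a : Fin r → A, ∑ ρ, a ρ * j ρ = 0 → ∀ ρ, a ρ ∈ maximalIdeal A)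
    (w₁ : g₁ ≫ p = hU'.fromSpec ≫ q) (hg₁ : g₁ ⁻¹ᵁ V' = ⊤)
    (h₀₁ : Spec.map (i.app U') ≫ g₁ = (isAffineOpen_preimage_of_isPullback_mk J hi ⟨U', hU'⟩).fromSpec ≫ f₀)
    (m : Fin r → I → Γ(Zb, Wb)) :
    ∃ (g₂ : Spec (.of Γ(Z, U')) ⟶ X) (_ : g₂ ⁻¹ᵁ V' = ⊤), g₂ ≫ p = hU'.fromSpec ≫ q ∧
      Spec.map (i.app U') ≫ g₂ = (isAffineOpen_preimage_of_isPullback_mk J hi ⟨U', hU'⟩).fromSpec ≫ f₀ ∧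
      ∀ (h₁' : (Spec.map (Z.presheaf.map (homOfLE (le_refl U')).op) ≫ g₁) ⁻¹ᵁ V' = ⊤)
        (h₂' : (Spec.map (Z.presheaf.map (homOfLE (le_refl U')).op) ≫ g₂) ⁻¹ᵁ V' = ⊤)
        (ψ₀ : Γ(X₀.left, G ⁻¹ᵁ V') →+* Γ(Zb, Wb)),
        (∀ a, ψ₀ (G.app V' a) = pr.appLE U' Wb hWb.le
          (((Spec.map (Z.presheaf.map (homOfLE (le_refl U')).op) ≫ g₁).appLE V' ⊤ h₁'.ge ≫
            (Scheme.ΓSpecIso (.of Γ(Z, U'))).hom) a)) →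
        ∀ (a : Γ(X, V')) (d : Fin r → Γ(Z, U')),
          ((Spec.map (Z.presheaf.map (homOfLE (le_refl U')).op) ≫ g₂).appLE V' ⊤ h₂'.ge ≫
              (Scheme.ΓSpecIso (.of Γ(Z, U'))).hom) a -
            ((Spec.map (Z.presheaf.map (homOfLE (le_refl U')).op) ≫ g₁).appLE V' ⊤ h₁'.ge ≫
              (Scheme.ΓSpecIso (.of Γ(Z, U'))).hom) a =
            ∑ ρ, Z.presheaf.map (homOfLE (le_top : U' ≤ ⊤)).op (specStructureMap q (j ρ)) * d ρ →
          ∀ ρ, pr.appLE U' Wb hWb.le (d ρ) =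
            ∑ t, ψ₀ (coord e (homOfLE le_top) (dSection X₀ (G ⁻¹ᵁ V') (G.app V' a)) t) * m ρ t := by
  classical
  letI algZ : Algebra A Γ(Z, U') :=
    ((Z.presheaf.map (homOfLE (le_top : U' ≤ ⊤)).op).hom.comp (specStructureMap q)).toAlgebra
  letI algV : Algebra A Γ(X, V') := ((Scheme.ΓSpecIso (.of A)).inv ≫ p.appLE ⊤ V' le_top).hom.toAlgebra
  letI algVB : Algebra Γ(X, V') Γ(Z, U') := (g₁.appLE V' ⊤ hg₁.ge ≫ (Scheme.ΓSpecIso (.of Γ(Z, U'))).hom).hom.toAlgebra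
  have hJ2 := mul_self_eq_bot_of_le_maximalIdeal J hmJ hJle
  obtain ⟨ε, ψ₀, ℓ, hψ₀, hℓ, hε⟩ := exists_derivation_of_matrix J j p hG e q hi hpr hU' hV' hWb g₁ hj hmJ hJle w₁ hg₁ m
  have halg : CommRingCat.ofHom (algebraMap A Γ(Z, U')) = (Scheme.ΓSpecIso (.of A)).inv ≫ q.appLE ⊤ U' le_top := rfl
  have w₁' : g₁ ≫ p = Spec.map (CommRingCat.ofHom (algebraMap A Γ(Z, U'))) := by
    rw [halg, ← fromSpec_comp_eq_specMap hU' q]; exact w₁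
  have hπ2 := ker_app_sq_eq_bot_of_isPullback_mk J hi hJ2 ⟨U', hU'⟩
  obtain ⟨g₂, hg₂, w₂', hred, hchart⟩ := exists_lift_of_derivation p (i.app U').hom hV' hπ2 g₁ w₁' hg₁ ε
  refine ⟨g₂, hg₂, ?_, ?_, ?_⟩
  · rw [w₂', halg, ← fromSpec_comp_eq_specMap hU' q]
  · rw [CommRingCat.ofHom_hom] at hred
    rw [← hred, h₀₁]
  intro h₁' h₂' ψ₀' hψ₀' a d hd ρ
  have E₁ := specMap_res_refl_comp (X := X) (Z := Z) g₁
  have E₂ := specMap_res_refl_comp (X := X) (Z := Z) g₂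
  rw [congrArg (fun φ => φ.hom a) (chart_congr E₁ h₁' hg₁), congrArg (fun φ => φ.hom a) (chart_congr E₂ h₂' hg₂)] at hd
  have hψ₀'' : ∀ a, ψ₀' (G.app V' a) =
      pr.appLE U' Wb hWb.le ((g₁.appLE V' ⊤ hg₁.ge ≫ (Scheme.ΓSpecIso (.of Γ(Z, U'))).hom) a) := fun a => by
    rw [hψ₀' a, congrArg (fun φ => φ.hom a) (chart_congr E₁ h₁' hg₁)]
  refine pchar_of_difference_eq J j p hG e q hpr hU' hV' hWb g₁ hind hg₁ m ψ₀ ℓ hψ₀ hℓ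
    (g₂.appLE V' ⊤ hg₂.ge ≫ (Scheme.ΓSpecIso (.of Γ(Z, U'))).hom).hom (fun a => ?_) ψ₀' hψ₀'' a d hd ρ
  rw [← hε a, sub_eq_iff_eq_add']
  exact hchart a

end Corrected

/-! ### §4 The cover: a coboundary glues to a global lift -/

section Glue

variable {A : Type u} [CommRing A] [IsLocalRing A] (J : Ideal A) {r : ℕ} (j : Fin r → A)
  {X : Scheme.{u}} (p : X ⟶ Spec (.of A)) {X₀ : Over (Spec (.of (A ⧸ J)))} {G : X₀.left ⟶ X}
  (hG : IsPullback G X₀.hom p (Spec.map (CommRingCat.ofHom (Ideal.Quotient.mk J))))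
  {I : Type u} [Fintype I] (e : SheafOfModules.free I ≅ (cotangentSheaf X₀).over ⊤)
  {Z Z₀ Zb : Scheme.{u}} (q : Z ⟶ Spec (.of A)) {q₀ : Z₀ ⟶ Spec (.of (A ⧸ J))} {i : Z₀ ⟶ Z}
  (hi : IsPullback i q₀ q (Spec.map (CommRingCat.ofHom (Ideal.Quotient.mk J))))
  {qb : Zb ⟶ Spec (.of (ResidueField A))} {pr : Zb ⟶ Z}
  (hpr : IsPullback pr qb q (Spec.map (CommRingCat.ofHom (residue A)))) (fZb : Zb ⟶ Spec (.of A))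
  (f₀ : Z₀ ⟶ X) {ι : Type u} (U : ι → Z.Opens) (V : ι → X.Opens) (Ub : ι → Zb.Opens)
  (hU : ∀ α, IsAffineOpen (U α)) (hU₂ : ∀ α β, IsAffineOpen (U α ⊓ U β)) (hcov : ⨆ α, U α = ⊤)
  (hV : ∀ α, IsAffineOpen (V α)) (hV₂ : ∀ α β, IsAffineOpen (V α ⊓ V β))
  (hUb : ∀ α, Ub α = pr ⁻¹ᵁ U α)
  (g : ∀ α, Spec (.of Γ(Z, U α)) ⟶ X) (w : ∀ α, g α ≫ p = (hU α).fromSpec ≫ q) (hg : ∀ α, (g α) ⁻¹ᵁ V α = ⊤)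
  (h₀ : ∀ α, Spec.map (i.app (U α)) ≫ g α = (isAffineOpen_preimage_of_isPullback_mk J hi ⟨U α, hU α⟩).fromSpec ≫ f₀)

include hU₂ in
/-- **The overlap chart is the fibre product of the two charts**: two local lifts which agree after restriction to
`Spec Γ(Z, U_α ∩ U_β)` agree after the two projections of `Spec Γ(Z, U_α) ×_Z Spec Γ(Z, U_β)` (an open immersion with the
same range `U_α ∩ U_β`, Mathlib `IsOpenImmersion.isoOfRangeEq`, `Scheme.Pullback.range_fst_comp`). [cite: SGA1, Exp. III §5 Prop. 5.1] -/
theorem pullback_fst_comp_eq_snd_comp_of_restrict_eq (α β : ι) (t₁ : Spec (.of Γ(Z, U α)) ⟶ X)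
    (t₂ : Spec (.of Γ(Z, U β)) ⟶ X)
    (h : Spec.map (Z.presheaf.map (homOfLE (inf_le_left : U α ⊓ U β ≤ U α)).op) ≫ t₁ =
      Spec.map (Z.presheaf.map (homOfLE (inf_le_right : U α ⊓ U β ≤ U β)).op) ≫ t₂) :
    pullback.fst (hU α).fromSpec (hU β).fromSpec ≫ t₁ = pullback.snd (hU α).fromSpec (hU β).fromSpec ≫ t₂ := by
  have hrange : Set.range (hU₂ α β).fromSpec =
      Set.range (pullback.fst (hU α).fromSpec (hU β).fromSpec ≫ (hU α).fromSpec) := by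
    rw [Scheme.Pullback.range_fst_comp, IsAffineOpen.range_fromSpec, IsAffineOpen.range_fromSpec,
      IsAffineOpen.range_fromSpec]
    rfl
  let l := IsOpenImmersion.isoOfRangeEq (hU₂ α β).fromSpec
    (pullback.fst (hU α).fromSpec (hU β).fromSpec ≫ (hU α).fromSpec) hrange
  have hl : l.hom ≫ (pullback.fst (hU α).fromSpec (hU β).fromSpec ≫ (hU α).fromSpec) = (hU₂ α β).fromSpec :=
    IsOpenImmersion.isoOfRangeEq_hom_fac _ _ _
  have hfst : l.hom ≫ pullback.fst (hU α).fromSpec (hU β).fromSpec =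
      Spec.map (Z.presheaf.map (homOfLE (inf_le_left : U α ⊓ U β ≤ U α)).op) := by
    rw [← cancel_mono (hU α).fromSpec, Category.assoc, hl, IsAffineOpen.map_fromSpec (hU α) (hU₂ α β)]
  have hsnd : l.hom ≫ pullback.snd (hU α).fromSpec (hU β).fromSpec =
      Spec.map (Z.presheaf.map (homOfLE (inf_le_right : U α ⊓ U β ≤ U β)).op) := by
    rw [← cancel_mono (hU β).fromSpec, Category.assoc, ← pullback.condition, hl,
      IsAffineOpen.map_fromSpec (hU β) (hU₂ α β)]
  rw [← cancel_epi l.hom, ← Category.assoc, ← Category.assoc, hfst, hsnd]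
  exact h

include hG hi hpr hU hU₂ hcov hV hV₂ hUb w hg h₀ in
/-- **A COBOUNDARY GLUES TO A GLOBAL LIFT** ([SGA1] III Prop. 5.1: if the class of the cocycle of local extensions
vanishes, the corrected local extensions patch; [MFK94] Prop. 6.15: «hence `β = 0`, and `μ₀` extends»).  In the setting
of ★ `exists_cechCocycle` with the `U_α` COVERING `Z`: if cochains `c ρ t` carrying the characteristic identities of the
local `S`-lifts `(g_α)` are Čech coboundaries, `c ρ t = d⁰(b ρ t)`, then `f₀` extends to a global `S`-morphism
`G_Z : Z → X` (`G_Z ≫ p = q`, `i ≫ G_Z = f₀`).  Proof: correct `g_α` by the derivation of matrix `−(b ρ t)_α` (★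
`exists_corrected_lift`); on `U_α ∩ U_β` the matrix of the corrected pair is `b_α − b_α + (b_β − b_α) − b_β + b_β… = 0`
(★ `matrix_add`, `matrix_restrict`), so the corrected lifts agree there (★ `charts_eq_of_matrix_zero`, O5 `eq_of_charts_eq`)
and glue (★ O5 `existsUnique_glue_of_lifts` / `glue_over` / `glue_comp_eq`).
[cite: SGA1, Exp. III §5 Prop. 5.1] [cite: MumfordFogartyKirwan1994, Ch. 6 §3 Prop. 6.15 (pp. 124–125)] -/
theorem exists_lift_of_cechCochain_mem_cechB1 [Flat q] (hj : ∀ ρ, j ρ ∈ J) (hspan : J ≤ Ideal.span (Set.range j))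
    (hind : ∀ a : Fin r → A, ∑ ρ, a ρ * j ρ = 0 → ∀ ρ, a ρ ∈ maximalIdeal A)
    (hmJ : maximalIdeal A * J = ⊥) (hJle : J ≤ maximalIdeal A)
    (c : Fin r → I → CechC1 fZb Ub)
    (hc : ∀ (α β : ι)
        (h₁' : (Spec.map (Z.presheaf.map (homOfLE (inf_le_left : U α ⊓ U β ≤ U α)).op) ≫ g α) ⁻¹ᵁ (V α ⊓ V β) = ⊤)
        (h₂' : (Spec.map (Z.presheaf.map (homOfLE (inf_le_right : U α ⊓ U β ≤ U β)).op) ≫ g β) ⁻¹ᵁ (V α ⊓ V β) = ⊤)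
        (ψ₀ : Γ(X₀.left, G ⁻¹ᵁ (V α ⊓ V β)) →+* Γ(Zb, Ub α ⊓ Ub β)),
        (∀ a, ψ₀ (G.app (V α ⊓ V β) a) =
          pr.appLE (U α ⊓ U β) (Ub α ⊓ Ub β) (inf_eq_preimage_inf U Ub hUb α β).le
            (((Spec.map (Z.presheaf.map (homOfLE (inf_le_left : U α ⊓ U β ≤ U α)).op) ≫ g α).appLE (V α ⊓ V β) ⊤
              h₁'.ge ≫ (Scheme.ΓSpecIso (.of Γ(Z, U α ⊓ U β))).hom) a)) →
        ∀ (a : Γ(X, V α ⊓ V β)) (d : Fin r → Γ(Z, U α ⊓ U β)),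
          ((Spec.map (Z.presheaf.map (homOfLE (inf_le_right : U α ⊓ U β ≤ U β)).op) ≫ g β).appLE (V α ⊓ V β) ⊤
              h₂'.ge ≫ (Scheme.ΓSpecIso (.of Γ(Z, U α ⊓ U β))).hom) a -
            ((Spec.map (Z.presheaf.map (homOfLE (inf_le_left : U α ⊓ U β ≤ U α)).op) ≫ g α).appLE (V α ⊓ V β) ⊤
              h₁'.ge ≫ (Scheme.ΓSpecIso (.of Γ(Z, U α ⊓ U β))).hom) a =
            ∑ ρ, Z.presheaf.map (homOfLE (le_top : U α ⊓ U β ≤ ⊤)).op (specStructureMap q (j ρ)) * d ρ →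
          ∀ ρ, pr.appLE (U α ⊓ U β) (Ub α ⊓ Ub β) (inf_eq_preimage_inf U Ub hUb α β).le (d ρ) =
            ∑ t, ψ₀ (coord e (homOfLE le_top) (dSection X₀ (G ⁻¹ᵁ (V α ⊓ V β)) (G.app (V α ⊓ V β) a)) t) *
              Sections.equiv fZb _ (c ρ t α β))
    (hB : ∀ ρ t, c ρ t ∈ cechB1 fZb Ub) :
    ∃ Gl : Z ⟶ X, Gl ≫ p = q ∧ i ≫ Gl = f₀ := by
  classical
  have hJ2 := mul_self_eq_bot_of_le_maximalIdeal J hmJ hJle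
  -- the 0-cochains
  have hB' : ∀ ρ t, ∃ b : CechC0 fZb Ub, cechD0 fZb Ub b = c ρ t := fun ρ t => (mem_cechB1_iff _ _ _).1 (hB ρ t)
  choose b hb using hB'
  -- the corrected lifts, chart by chart, with matrix `−b_α`
  have corr := fun α => exists_corrected_lift J j p hG e q hi hpr f₀ (hU α) (hV α) (hUb α) (g α) hj hmJ hJle hind
    (w α) (hg α) (h₀ α) (fun ρ t => -(Sections.equiv fZb _ (b ρ t α)))
  choose gt hgtV wgt h₀gt Pgt using corr
  -- the two families `gg true = g`, `gg false = gt`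
  let gg : Bool → ∀ α, (Spec (.of Γ(Z, U α)) ⟶ X) := fun bb α => Bool.rec (gt α) (g α) bb
  have wgg : ∀ bb α, gg bb α ≫ p = (hU α).fromSpec ≫ q := by rintro (_ | _) α; exacts [wgt α, w α]
  have h₀gg : ∀ bb α, Spec.map (i.app (U α)) ≫ gg bb α =
      (isAffineOpen_preimage_of_isPullback_mk J hi ⟨U α, hU α⟩).fromSpec ≫ f₀ := by rintro (_ | _) α; exacts [h₀gt α, h₀ α]
  have hggV : ∀ bb α, (gg bb α) ⁻¹ᵁ V α = ⊤ := by rintro (_ | _) α; exacts [hgtV α, hg α]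
  have land : ∀ (b₁ b₂ : Bool) (k m : ι) {W : Z.Opens} (hW : IsAffineOpen W) (hk : W ≤ U k) (hm : W ≤ U m),
      (Spec.map (Z.presheaf.map (homOfLE hk).op) ≫ gg b₁ k) ⁻¹ᵁ V m = ⊤ := fun b₁ b₂ k m W hW hk hm =>
    restrict_preimage_eq_top_of_right J q hi f₀ (hU k) (hU m) hW hk hm (gg b₁ k) (gg b₂ m) hJ2 (hggV b₂ m)
      (h₀gg b₁ k) (h₀gg b₂ m)
  have land₂ : ∀ (bb : Bool) (k α β : ι) (hk : U α ⊓ U β ≤ U k),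
      (Spec.map (Z.presheaf.map (homOfLE hk).op) ≫ gg bb k) ⁻¹ᵁ (V α ⊓ V β) = ⊤ := fun bb k α β hk => by
    rw [Scheme.Hom.preimage_inf, land bb bb k α (hU₂ α β) hk inf_le_left, land bb bb k β (hU₂ α β) hk inf_le_right,
      top_inf_eq]
  have land₁ : ∀ (bb : Bool) (α : ι), (Spec.map (Z.presheaf.map (homOfLE (le_refl (U α))).op) ≫ gg bb α) ⁻¹ᵁ V α = ⊤ :=
    fun bb α => land bb bb α α (hU α) le_rfl le_rfl
  have P1 := fun (b₁ b₂ : Bool) (α : ι) => difference_leibniz_and_mem_ker J p q hi f₀ (hU α) (hU α) (hU α) le_rfl le_rfl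
    (gg b₁ α) (gg b₂ α) hJ2 (hV α) (wgg b₁ α) (wgg b₂ α) (h₀gg b₁ α) (h₀gg b₂ α) (land₁ b₁ α) (land₁ b₂ α) _ _ rfl rfl
  have P2 := fun (b₁ b₂ : Bool) (k m α β : ι) (hk : U α ⊓ U β ≤ U k) (hm : U α ⊓ U β ≤ U m) =>
    difference_leibniz_and_mem_ker J p q hi f₀ (hU k) (hU m) (hU₂ α β) hk hm (gg b₁ k) (gg b₂ m) hJ2 (hV₂ α β)
      (wgg b₁ k) (wgg b₂ m) (h₀gg b₁ k) (h₀gg b₂ m) (land₂ b₁ k α β hk) (land₂ b₂ m α β hm) _ _ rfl rfl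
  have M2 := fun (b₁ b₂ : Bool) (k m α β : ι) (hk : U α ⊓ U β ≤ U k) (hm : U α ⊓ U β ≤ U m) =>
    exists_coords_of_pair J j p hG e q hi hpr f₀ (hU k) (hU m) (hU₂ α β) hk hm (inf_eq_preimage_inf U Ub hUb α β)
      (hV₂ α β) (gg b₁ k) (gg b₂ m) hj hspan hind hmJ hJle (wgg b₁ k) (wgg b₂ m) (h₀gg b₁ k) (h₀gg b₂ m)
      (land₂ b₁ k α β hk) (land₂ b₂ m α β hm) _ _ rfl rfl
  -- the corrected lifts agree on the overlaps
  have hagree : ∀ α β, Spec.map (Z.presheaf.map (homOfLE (inf_le_left : U α ⊓ U β ≤ U α)).op) ≫ gt α =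
      Spec.map (Z.presheaf.map (homOfLE (inf_le_right : U α ⊓ U β ≤ U β)).op) ≫ gt β := by
    intro α β
    have hα : U α ⊓ U β ≤ U α := inf_le_left
    have hβ : U α ⊓ U β ≤ U β := inf_le_right
    have toJ₂ : ∀ {x : Γ(Z, U α ⊓ U β)}, x ∈ RingHom.ker (i.app (U α ⊓ U β)).hom →
        x ∈ J.map ((Z.presheaf.map (homOfLE (le_top : U α ⊓ U β ≤ ⊤)).op).hom.comp (specStructureMap q)) :=
      fun hx => by rwa [(app_surjective_and_ker_eq_of_isPullback_mk J hi ⟨U α ⊓ U β, hU₂ α β⟩).2] at hx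
    have toJ₁ : ∀ (γ : ι) {x : Γ(Z, U γ)}, x ∈ RingHom.ker (i.app (U γ)).hom →
        x ∈ J.map ((Z.presheaf.map (homOfLE (le_top : U γ ≤ ⊤)).op).hom.comp (specStructureMap q)) :=
      fun γ x hx => by rwa [(app_surjective_and_ker_eq_of_isPullback_mk J hi ⟨U γ, hU γ⟩).2] at hx
    -- level-2 matrices: S = (gt α, g α), T = (g α, g β) [= c], R = (g β, gt β), and the composites
    obtain ⟨S, hS⟩ := M2 false true α α α β hα hα
    obtain ⟨R, hR⟩ := M2 true false β β α β hβ hβ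
    obtain ⟨ST, hST⟩ := M2 false true α β α β hα hβ
    obtain ⟨STR, hSTR⟩ := M2 false false α β α β hα hβ
    obtain ⟨S', hS'⟩ := M2 true false α α α β hα hα
    obtain ⟨Z0, hZ0⟩ := M2 false false α α α β hα hα
    have A1 : ST = S + fun ρ t => Sections.equiv fZb _ (c ρ t α β) :=
      matrix_add J j p hG e q hpr hspan hJle (hV₂ α β) (hU₂ α β) (inf_eq_preimage_inf U Ub hUb α β) _ _ _
        (fun x => (P2 false true α α α β hα hα).2.1 x) (fun a => toJ₂ ((P2 false true α α α β hα hα).2.2.2 a))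
        (fun a => toJ₂ ((P2 true true α β α β hα hβ).2.2.2 a)) hS
        (fun ψ₀ hψ₀ a d hd ρ => hc α β (land₂ true α α β hα) (land₂ true β α β hβ) ψ₀ hψ₀ a d hd ρ) hST
    have A2 : STR = ST + R :=
      matrix_add J j p hG e q hpr hspan hJle (hV₂ α β) (hU₂ α β) (inf_eq_preimage_inf U Ub hUb α β) _ _ _
        (fun x => (P2 false true α α α β hα hα).2.1 x) (fun a => toJ₂ ((P2 false true α β α β hα hβ).2.2.2 a))
        (fun a => toJ₂ ((P2 true false β β α β hβ hβ).2.2.2 a)) hST hR hSTR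
    have A3 : Z0 = S + S' :=
      matrix_add J j p hG e q hpr hspan hJle (hV₂ α β) (hU₂ α β) (inf_eq_preimage_inf U Ub hUb α β) _ _ _
        (fun x => (P2 false true α α α β hα hα).2.1 x) (fun a => toJ₂ ((P2 false true α α α β hα hα).2.2.2 a))
        (fun a => toJ₂ ((P2 true false α α α β hα hα).2.2.2 a)) hS hS' hZ0
    have hZ0' : Z0 = 0 :=
      matrix_eq_zero_of_eq J j p hG e q hpr hJle (hV₂ α β) (hU₂ α β) (inf_eq_preimage_inf U Ub hUb α β) _
        (fun x => (P2 false true α α α β hα hα).2.1 x) hZ0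
    -- restriction from level 1: `S' = −b_α|`, `R = −b_β|`
    have hres : ∀ (k : ι) (hk : U α ⊓ U β ≤ U k) (hbk : Ub α ⊓ Ub β ≤ Ub k) (l : V α ⊓ V β ≤ V k)
        (cm₂ : Fin r → I → Γ(Zb, Ub α ⊓ Ub β)),
        (∀ (ψ₀ : Γ(X₀.left, G ⁻¹ᵁ (V α ⊓ V β)) →+* Γ(Zb, Ub α ⊓ Ub β)),
          (∀ a, ψ₀ (G.app (V α ⊓ V β) a) = pr.appLE (U α ⊓ U β) (Ub α ⊓ Ub β) (inf_eq_preimage_inf U Ub hUb α β).le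
            (((Spec.map (Z.presheaf.map (homOfLE hk).op) ≫ gg true k).appLE (V α ⊓ V β) ⊤ (land₂ true k α β hk).ge ≫
              (Scheme.ΓSpecIso (.of Γ(Z, U α ⊓ U β))).hom) a)) →
          ∀ (a : Γ(X, V α ⊓ V β)) (d : Fin r → Γ(Z, U α ⊓ U β)),
            ((Spec.map (Z.presheaf.map (homOfLE hk).op) ≫ gg false k).appLE (V α ⊓ V β) ⊤ (land₂ false k α β hk).ge ≫
                (Scheme.ΓSpecIso (.of Γ(Z, U α ⊓ U β))).hom) a -
              ((Spec.map (Z.presheaf.map (homOfLE hk).op) ≫ gg true k).appLE (V α ⊓ V β) ⊤ (land₂ true k α β hk).ge ≫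
                (Scheme.ΓSpecIso (.of Γ(Z, U α ⊓ U β))).hom) a =
              ∑ ρ, Z.presheaf.map (homOfLE (le_top : U α ⊓ U β ≤ ⊤)).op (specStructureMap q (j ρ)) * d ρ →
            ∀ ρ, pr.appLE (U α ⊓ U β) (Ub α ⊓ Ub β) (inf_eq_preimage_inf U Ub hUb α β).le (d ρ) =
              ∑ t, ψ₀ (coord e (homOfLE le_top) (dSection X₀ (G ⁻¹ᵁ (V α ⊓ V β)) (G.app (V α ⊓ V β) a)) t) * cm₂ ρ t) →
        cm₂ = fun ρ t => Zb.presheaf.map (homOfLE hbk).op (-(Sections.equiv fZb _ (b ρ t k))) := by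
      intro k hk hbk l cm₂ h2
      have E₁ := specMap_res_comp_eq (X := X) (le_refl (U k)) hk (gg true k)
      have E₂ := specMap_res_comp_eq (X := X) (le_refl (U k)) hk (gg false k)
      have hl₁' : (Spec.map (Z.presheaf.map (homOfLE hk).op) ≫
          (Spec.map (Z.presheaf.map (homOfLE (le_refl (U k))).op) ≫ gg true k)) ⁻¹ᵁ (V α ⊓ V β) = ⊤ := by
        rw [E₁]; exact land₂ true k α β hk
      have hl₂' : (Spec.map (Z.presheaf.map (homOfLE hk).op) ≫
          (Spec.map (Z.presheaf.map (homOfLE (le_refl (U k))).op) ≫ gg false k)) ⁻¹ᵁ (V α ⊓ V β) = ⊤ := by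
        rw [E₂]; exact land₂ false k α β hk
      refine matrix_restrict J j p hG e q hpr hspan hJle (hV k) (hV₂ α β) l (hU k) (hU₂ α β) hk (hUb k)
        (inf_eq_preimage_inf U Ub hUb α β) hbk _ _ _ _ (fun x => (P1 true false k).2.1 x)
        (fun x => (P2 true false k k α β hk hk).2.1 x) (fun a => ?_) (fun a => ?_)
        (fun a => toJ₁ k ((P1 true false k).2.2.2 a)) (Pgt k (land₁ true k) (land₁ false k)) h2
      · rw [congrArg (fun φ => φ.hom (X.presheaf.map (homOfLE l).op a)) (chart_congr E₁.symm (land₂ true k α β hk) hl₁')]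
        exact chart_restrict_apply (hV k) l _ (land₁ true k) _ hl₁' a
      · rw [congrArg (fun φ => φ.hom (X.presheaf.map (homOfLE l).op a)) (chart_congr E₂.symm (land₂ false k α β hk) hl₂')]
        exact chart_restrict_apply (hV k) l _ (land₁ false k) _ hl₂' a
    have RS' := hres α hα inf_le_left inf_le_left S' hS'
    have RR := hres β hβ inf_le_right inf_le_right R hR
    -- the total matrix vanishes: `STR = S + c + R = −S' + (b_β − b_α)| + R = b_α| + b_β| − b_α| − b_β| = 0`
    have hcd : ∀ ρ t, (Sections.equiv fZb _ (c ρ t α β) : Γ(Zb, Ub α ⊓ Ub β)) =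
        Zb.presheaf.map (homOfLE (inf_le_right : Ub α ⊓ Ub β ≤ Ub β)).op (Sections.equiv fZb _ (b ρ t β)) -
          Zb.presheaf.map (homOfLE (inf_le_left : Ub α ⊓ Ub β ≤ Ub α)).op (Sections.equiv fZb _ (b ρ t α)) := by
      intro ρ t
      have h1 := congrFun (congrFun (hb ρ t) α) β
      rw [cechD0_apply] at h1
      exact h1.symm
    have htot : STR = 0 := by
      funext ρ t
      have e1 := congrFun (congrFun A2 ρ) t
      have e2 := congrFun (congrFun A1 ρ) t
      have e3 : S ρ t = -(S' ρ t) := by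
        have h := congrFun (congrFun A3 ρ) t
        rw [hZ0'] at h
        simp only [Pi.zero_apply, Pi.add_apply] at h
        exact eq_neg_of_add_eq_zero_left h.symm
      have e4 := congrFun (congrFun RS' ρ) t
      have e5 := congrFun (congrFun RR ρ) t
      simp only [Pi.add_apply] at e1 e2
      simp only at e4 e5
      rw [e1, e2, e3, e4, e5, hcd, map_neg, map_neg]
      simp only [Pi.zero_apply]
      abel
    -- hence equal charts, hence equal morphisms
    subst htot
    have heq := charts_eq_of_matrix_zero J j p hG e q hpr hj hspan hmJ hJle (hV₂ α β) (hU₂ α β)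
      (inf_eq_preimage_inf U Ub hUb α β) _ _ (fun x => (P2 false false α β α β hα hβ).2.1 x)
      (fun a => toJ₂ ((P2 false false α β α β hα hβ).2.2.2 a)) hSTR
    refine eq_of_charts_eq (hV₂ α β) (land₂ false α α β hα) (land₂ false β α β hβ) ?_
    ext a
    exact (heq a).symm
  -- glue
  let 𝒰 : Z.OpenCover := Scheme.Cover.mkOfCovers (P := @IsOpenImmersion) ι (fun α => Spec (.of Γ(Z, U α)))
    (fun α => (hU α).fromSpec) (fun z => by
      have hz : z ∈ (⨆ α, U α) := by rw [hcov]; trivial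
      obtain ⟨α, hα⟩ := TopologicalSpace.Opens.mem_iSup.mp hz
      have hz' : z ∈ Set.range (hU α).fromSpec := by rw [IsAffineOpen.range_fromSpec]; exact hα
      obtain ⟨y, hy⟩ := hz'
      exact ⟨α, y, hy⟩) (fun α => inferInstance)
  have hover : ∀ α β, pullback.fst (𝒰.f α) (𝒰.f β) ≫ gt α = pullback.snd (𝒰.f α) (𝒰.f β) ≫ gt β := fun α β =>
    pullback_fst_comp_eq_snd_comp_of_restrict_eq U hU hU₂ α β (gt α) (gt β) (hagree α β)
  obtain ⟨Gl, hGl, -⟩ := existsUnique_glue_of_lifts 𝒰 gt hover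
  refine ⟨Gl, glue_over 𝒰 gt p q hGl (fun α => wgt α), ?_⟩
  let 𝒰₀ : Z₀.OpenCover := Scheme.Cover.mkOfCovers (P := @IsOpenImmersion) ι (fun α => Spec (.of Γ(Z₀, i ⁻¹ᵁ U α)))
    (fun α => (isAffineOpen_preimage_of_isPullback_mk J hi ⟨U α, hU α⟩).fromSpec) (fun z => by
      have hz : z ∈ (⨆ α, i ⁻¹ᵁ U α) := by
        rw [← Scheme.Hom.preimage_iSup, hcov, Scheme.Hom.preimage_top]; trivial
      obtain ⟨α, hα⟩ := TopologicalSpace.Opens.mem_iSup.mp hz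
      have hz' : z ∈ Set.range (isAffineOpen_preimage_of_isPullback_mk J hi ⟨U α, hU α⟩).fromSpec := by
        rw [IsAffineOpen.range_fromSpec]; exact hα
      obtain ⟨y, hy⟩ := hz'
      exact ⟨α, y, hy⟩) (fun α => inferInstance)
  refine glue_comp_eq 𝒰 gt i f₀ 𝒰₀ id (fun α => Spec.map (i.app (U α))) (fun α => ?_) hGl (fun α => h₀gt α)
  change Spec.map (i.app (U α)) ≫ (hU α).fromSpec = (isAffineOpen_preimage_of_isPullback_mk J hi ⟨U α, hU α⟩).fromSpec ≫ i
  rw [Scheme.Hom.app_eq_appLE]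
  exact IsAffineOpen.SpecMap_appLE_fromSpec i (hU α) (isAffineOpen_preimage_of_isPullback_mk J hi ⟨U α, hU α⟩) le_rfl

end Glue

end Literature.AlgebraicGeometry.Deformation

end
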